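import Summits.QuantumFields.BalabanUV.T4Continuum.Support.NE7PairChartData
import HarnessLib

/-!
# NE7PairChartDataGeneric — PORT MAP P2.5a: THE PAIR CHART DATA AT ANY BLOCK SIZE `L ≥ 2` (F323a `NE7PairChartData.exists_pair_chart_data`, `L = 2`, `M = 2^{k+1}`, RE-ISSUED with
# `M = L^{k+1}`): two unitary `(N·M)`-periodic configurations with plaquettes `η`-close to `1` and THE SAME `(k+1)`-fold `L`-block average have corner-segment transporters within
# `20480·M²η` (`corner_segment_datum_generic`) and the pinned `N`-equivariant chart family on the radius-`M` cubes with cube letter `262144·Mη` and site-closeness `4358144·M²η`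
# (`exists_pair_chart_data_generic`), as soon as `10¹²·L⁶·card n·M²η ≤ 1` (the factor `L⁶` feeds row Y9's `twoLevelSmall 4 L = 65536·25·64·L⁸` line of the level family)

Cell `pub-balaban`, rung (B)+1 sub-cell t4, lineage `b2b-balaban-t4-ne7-p1`, generation 109 (CRUX PROVER NE7 #1 = OWNER of BINDER row NE7).  Memo
`t4/b2b-balaban-t4-ne7-p1-g109/ROAD-G109.md` §3 (PORT MAP item P2.5a).  Every building block is ALREADY `M`∕`L`-generic in the tree (F323a §1 `chart_regime`, `NE7PairCubeChart.exists_pair_chart_family`,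
`NE7PairChartCorners.norm_chart_sub_chart_le`, `NE7IteratedAverageSegment.norm_cavgIter_sub_seg_le_top`, `NE7SliceInduction.segSum_le`, row NE3-R2's `levelSmall_of_small`); only the
wrapper fixed `L = 2`.
WHAT ([folklore]; 0 def, 0 sorry).  `corner_segment_datum_generic`, **`exists_pair_chart_data_generic`**.
HONEST FRAMING (page 1): a theorem about ARBITRARY pairs of small-field lattice gauge fields with equal top averages; nothing of Bałaban's asserted; NE7 NOT proved; spine 0∕9; finite T⁴ rung
(B)+1 — NOT infinite volume, NOT mass gap, NOT BetaPertH, NOT Clay (continuum YM on T⁴ ⇐ BetaPertH ∧ nine spine estimates).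
-/

set_option autoImplicit false

open scoped BigOperators Matrix Matrix.Norms.L2Operator
open Finset NormedSpace

namespace Summit.QuantumFields.BalabanUV.T4Continuum.NE7PairChartDataGeneric

open Literature.MathematicalPhysics.QuantumFieldTheory.Balaban1983to89
open B7Prop1Explicit B7Prop2Explicit
open T4AveragingDeficitWall (IsUnitaryCfg SmallField)
open T4AveragingDeficitWallBoundary (IsPeriodicCfg)
open AveragingDeficitTwoLevelPrep (twoLevelSmall)
open AveragingDeficitMultiLevelPrep (cavgIter LevelSmall radIter)
open SpreadLift (loopRad)
open NE3ClassRadiusFamily (levelSmall_of_small)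
open NE7IteratedAverageSegment (norm_cavgIter_sub_seg_le_top)
open NE7SliceInduction (segSum_le)
open NE7PairCubeChart (exists_pair_chart_family)
open NE7PairChartCorners (norm_chart_sub_chart_le)
open NE7PairChartData (chart_regime)

noncomputable section

variable {n : Type} [Fintype n] [DecidableEq n] [Nonempty n]

/-! ## §2 The corner-segment datum from equal top averages -/

/-- **THE CORNER-SEGMENT DATUM, ANY BLOCK SIZE `L ≥ 2`**: two unitary configurations with `SmallField · η`, the SAME `(k+1)`-fold average (`M = L^{k+1}`) and
`10¹²·L⁶·M²η ≤ 1` have corner-segment transporters within `S = 20480·M²η`. [folklore] -/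
theorem corner_segment_datum_generic {L : ℕ} (hL : 2 ≤ L) {U' Us : Site 4 → Fin 4 → (Matrix n n ℂ)ˣ} (hU' : IsUnitaryCfg U') (hUs : IsUnitaryCfg Us) {k : ℕ} {η : ℝ} (hη : 0 ≤ η)
    (hS' : SmallField U' η) (hSs : SmallField Us η) (htop : cavgIter L (k + 1) U' = cavgIter L (k + 1) Us)
    (hθ : 1000000000000 * (L : ℝ) ^ 6 * (((L : ℝ) ^ (k + 1)) ^ 2 * η) ≤ 1) (ξ : Site 4) (i : Fin 4) :
    ‖((hol U' (((L ^ (k + 1) : ℕ) : ℤ) • ξ) (seg i ((L ^ (k + 1) : ℕ) : ℤ)) : (Matrix n n ℂ)ˣ) : Matrix n n ℂ)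
        - ((hol Us (((L ^ (k + 1) : ℕ) : ℤ) • ξ) (seg i ((L ^ (k + 1) : ℕ) : ℤ)) : (Matrix n n ℂ)ˣ) : Matrix n n ℂ)‖
      ≤ 20480 * (((L : ℝ) ^ (k + 1)) ^ 2 * η) := by
  have hL1 : 1 ≤ L := by omega
  have hL0 : (0 : ℝ) < L := by exact_mod_cast (show 0 < L by omega)
  have hL2r : (2 : ℝ) ≤ L := by exact_mod_cast hL
  have hL6 : (64 : ℝ) ≤ (L : ℝ) ^ 6 := by nlinarith [pow_le_pow_left₀ (by norm_num : (0:ℝ) ≤ 2) hL2r 6]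
  set θ : ℝ := ((L : ℝ) ^ (k + 1)) ^ 2 * η with hθdef
  have hθ0 : 0 ≤ θ := by positivity
  have hθ1 : 1000000000000 * θ ≤ 1 := by nlinarith
  have hθL : 1000000000000 * (L : ℝ) ^ 6 * θ ≤ 1 := hθ
  -- the multi-level class from the line
  have hk : (L : ℝ) ^ 2 * ((((L : ℝ)) ^ 2) ^ k * η) = θ := by
    rw [hθdef, ← pow_mul]
    ring
  have hk0 : 0 ≤ (((L : ℝ)) ^ 2) ^ k * η := by positivity
  have hs : LevelSmall 4 L k η := by
    refine levelSmall_of_small (d := 4) hL k hη ?_ ?_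
    · calc 14464 * (((4 : ℕ) : ℝ) + 1) ^ 2 * (((4 : ℕ) : ℝ) + 4) ^ 2 * (L : ℝ) ^ 2 * (8 / 3 * (((L : ℝ) ^ 2) ^ k * η))
          = 14464 * (((4 : ℕ) : ℝ) + 1) ^ 2 * (((4 : ℕ) : ℝ) + 4) ^ 2 * (8 / 3) * ((L : ℝ) ^ 2 * ((((L : ℝ)) ^ 2) ^ k * η)) := by ring
        _ = 14464 * (((4 : ℕ) : ℝ) + 1) ^ 2 * (((4 : ℕ) : ℝ) + 4) ^ 2 * (8 / 3) * θ := by rw [hk]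
        _ ≤ 1 / 2 := by push_cast; nlinarith
    · -- `2·twoLevelSmall 4 L·((L²)^k η) = 2·65536·25·64·L⁸·(θ∕L²) = 209715200·L⁶·θ ≤ 1`
      have e : 2 * twoLevelSmall 4 L * (((L : ℝ) ^ 2) ^ k * η) = 209715200 * (L : ℝ) ^ 6 * θ := by
        rw [← hk]; simp only [twoLevelSmall]; push_cast; ring
      rw [e]; nlinarith [mul_nonneg (pow_nonneg hL0.le 6) hθ0]
  have hA₁ : 14464 * (((3 + 1 : ℕ) : ℝ) + 1) ^ 2 * (((3 + 1 : ℕ) : ℝ) + 4) ^ 2 * (8 / 3) * (((L : ℝ) ^ (k + 1)) ^ 2 * η) ≤ 1 / 2 := by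
    rw [← hθdef]; push_cast; nlinarith
  have hsum := segSum_le (d := 3) hL (le_refl k) hη hA₁
  have hsum' : ∑ m ∈ Finset.range (k + 1), (L : ℝ) ^ (k - m) * (4 * loopRad 4 L (radIter 4 L m η)) ≤ 10240 * θ := by
    have e4 : 256 * ((((3 + 1 : ℕ) : ℝ) + 1) * (((3 + 1 : ℕ) : ℝ) + 4)) * ((L : ℝ) ^ (k + 1)) ^ 2 * η = 10240 * θ := by
      rw [hθdef]; push_cast; ring
    rw [← e4]; exact hsum
  have h1 := norm_cavgIter_sub_seg_le_top hL1 k hU' hη hs hS' ξ i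
  have h2 := norm_cavgIter_sub_seg_le_top hL1 k hUs hη hs hSs ξ i
  have hC : (cavgIter L (k + 1) U' ξ i : (Matrix n n ℂ)ˣ) = cavgIter L (k + 1) Us ξ i := by rw [htop]
  set A : Matrix n n ℂ := ((hol U' (((L ^ (k + 1) : ℕ) : ℤ) • ξ) (seg i ((L ^ (k + 1) : ℕ) : ℤ)) : (Matrix n n ℂ)ˣ) : Matrix n n ℂ) with hA
  set B : Matrix n n ℂ := ((hol Us (((L ^ (k + 1) : ℕ) : ℤ) • ξ) (seg i ((L ^ (k + 1) : ℕ) : ℤ)) : (Matrix n n ℂ)ˣ) : Matrix n n ℂ) with hB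
  set C : Matrix n n ℂ := ((cavgIter L (k + 1) U' ξ i : (Matrix n n ℂ)ˣ) : Matrix n n ℂ) with hCdef
  have hC' : ((cavgIter L (k + 1) Us ξ i : (Matrix n n ℂ)ˣ) : Matrix n n ℂ) = C := by rw [hCdef, hC]
  rw [hC'] at h2
  calc ‖A - B‖ = ‖(A - C) + (C - B)‖ := by rw [sub_add_sub_cancel]
    _ ≤ ‖A - C‖ + ‖C - B‖ := norm_add_le _ _
    _ ≤ 10240 * θ + 10240 * θ := by
        refine add_le_add (h1.trans hsum') ?_
        rw [norm_sub_rev]; exact h2.trans hsum'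
    _ = _ := by ring

/-! ## §3 The chart data bundle -/

/-- **THE PAIR CHART DATA, ANY BLOCK SIZE `L ≥ 2`**: the pinned `N`-equivariant family on the radius-`M` cubes (`M = L^{k+1}`) with cube letter `262144·Mη` and
site-closeness `4358144·M²η`, for unitary `(N·M)`-periodic `U′`, `U_s` with `SmallField · η`, equal `(k+1)`-fold averages and `10¹²·L⁶·card n·M²η ≤ 1`. [folklore] -/
theorem exists_pair_chart_data_generic {L : ℕ} (hL : 2 ≤ L) {U' Us : Site 4 → Fin 4 → (Matrix n n ℂ)ˣ} (hU' : IsUnitaryCfg U') (hUs : IsUnitaryCfg Us) {k N : ℕ}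
    (hU'P : IsPeriodicCfg U' ((N * L ^ (k + 1) : ℕ) : ℤ)) (hUsP : IsPeriodicCfg Us ((N * L ^ (k + 1) : ℕ) : ℤ)) {η : ℝ} (hη : 0 < η)
    (hS' : SmallField U' η) (hSs : SmallField Us η) (htop : cavgIter L (k + 1) U' = cavgIter L (k + 1) Us)
    (hθ : 1000000000000 * (L : ℝ) ^ 6 * (Fintype.card n : ℝ) * (((L : ℝ) ^ (k + 1)) ^ 2 * η) ≤ 1) :
    ∃ g : Site 4 → Site 4 → (Matrix n n ℂ)ˣ,
      (∀ ζ x, g ζ x ∈ unitaryUnits (Matrix n n ℂ)) ∧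
      (∀ ζ, g ζ (((L ^ (k + 1) : ℕ) : ℤ) • ζ) = 1) ∧
      (∀ (ζ x : Site 4) (κ : Fin 4), (∀ i, |x i - ((L ^ (k + 1) : ℕ) : ℤ) * ζ i| ≤ ((L ^ (k + 1) : ℕ) : ℤ)) →
        ‖(((Us x κ)⁻¹ * gaugeAct (g ζ) U' x κ : (Matrix n n ℂ)ˣ) : Matrix n n ℂ) - 1‖ ≤ 262144 * ((L : ℝ) ^ (k + 1)) * η) ∧
      (∀ (ζ x : Site 4) (i : Fin 4), g (ζ + (N : ℤ) • e i) (x + ((N * L ^ (k + 1) : ℕ) : ℤ) • e i) = g ζ x) ∧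
      (∀ (ζ ζ' x : Site 4), (∀ i, |x i - ((L ^ (k + 1) : ℕ) : ℤ) * ζ i| ≤ ((L ^ (k + 1) : ℕ) : ℤ)) →
        (∀ i, |x i - ((L ^ (k + 1) : ℕ) : ℤ) * ζ' i| ≤ ((L ^ (k + 1) : ℕ) : ℤ)) →
        ‖((g ζ x : (Matrix n n ℂ)ˣ) : Matrix n n ℂ) - ((g ζ' x : (Matrix n n ℂ)ˣ) : Matrix n n ℂ)‖ ≤ 4358144 * (((L : ℝ) ^ (k + 1)) ^ 2 * η)) := by
  letI : CStarAlgebra (Matrix n n ℂ) := {}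
  have hL0 : (0 : ℝ) < L := by exact_mod_cast (show 0 < L by omega)
  have hL2r : (2 : ℝ) ≤ L := by exact_mod_cast hL
  have hL6 : (1 : ℝ) ≤ (L : ℝ) ^ 6 := one_le_pow₀ (by linarith)
  set M : ℕ := L ^ (k + 1) with hMdef
  have hM2 : 2 ≤ M := by
    rw [hMdef]
    calc 2 ≤ L := hL
      _ = L ^ 1 := (pow_one L).symm
      _ ≤ L ^ (k + 1) := Nat.pow_le_pow_right (by omega) (by omega)
  have hM1 : 1 ≤ M := le_trans (by norm_num) hM2
  have hMr : (M : ℝ) = (L : ℝ) ^ (k + 1) := by rw [hMdef]; push_cast; ring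
  have hcard : (1 : ℝ) ≤ Fintype.card n := by exact_mod_cast Fintype.card_pos
  have hθL : 1000000000000 * (L : ℝ) ^ 6 * ((M : ℝ) ^ 2 * η) ≤ 1 := by
    rw [hMr]
    have : (L : ℝ) ^ 6 * (((L : ℝ) ^ (k + 1)) ^ 2 * η) ≤ (L : ℝ) ^ 6 * (Fintype.card n : ℝ) * (((L : ℝ) ^ (k + 1)) ^ 2 * η) := by
      rw [mul_assoc ((L : ℝ) ^ 6)]
      exact mul_le_mul_of_nonneg_left (le_mul_of_one_le_left (by positivity) hcard) (by positivity)
    nlinarith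
  have hθ' : 1000000000000 * (Fintype.card n : ℝ) * ((M : ℝ) ^ 2 * η) ≤ 1 := by
    rw [hMr]
    have : (Fintype.card n : ℝ) * (((L : ℝ) ^ (k + 1)) ^ 2 * η) ≤ (L : ℝ) ^ 6 * (Fintype.card n : ℝ) * (((L : ℝ) ^ (k + 1)) ^ 2 * η) := by
      rw [mul_assoc ((L : ℝ) ^ 6)]
      exact le_mul_of_one_le_left (by positivity) hL6
    nlinarith
  obtain ⟨hε', hR1, hR2, hηch⟩ := chart_regime hM2 hη hcard hθ'
  obtain ⟨g, hgU, hpin, herr, hgeq⟩ := exists_pair_chart_family hU' hUs hU'P hUsP hη hS' hSs hε' hR1 hR2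
  have herr' : ∀ (ζ x : Site 4) (κ : Fin 4), (∀ i, |x i - (M : ℤ) * ζ i| ≤ (M : ℤ)) →
      ‖(((Us x κ)⁻¹ * gaugeAct (g ζ) U' x κ : (Matrix n n ℂ)ˣ) : Matrix n n ℂ) - 1‖ ≤ 262144 * (M : ℝ) * η :=
    fun ζ x κ hx => (herr ζ x κ hx).trans hηch
  -- the corner-segment datum and F318's site-closeness
  have hS : ∀ (ξ : Site 4) (i : Fin 4), ‖((hol U' ((M : ℤ) • ξ) (seg i (M : ℤ)) : (Matrix n n ℂ)ˣ) : Matrix n n ℂ)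
      - ((hol Us ((M : ℤ) • ξ) (seg i (M : ℤ)) : (Matrix n n ℂ)ˣ) : Matrix n n ℂ)‖ ≤ 20480 * ((M : ℝ) ^ 2 * η) := by
    intro ξ i
    have h := corner_segment_datum_generic hL hU' hUs hη.le hS' hSs htop (by rw [← hMr]; exact hθL) ξ i
    rw [hMr]; rw [hMdef]; exact h
  have hclose : ∀ (ζ ζ' x : Site 4), (∀ i, |x i - (M : ℤ) * ζ i| ≤ (M : ℤ)) → (∀ i, |x i - (M : ℤ) * ζ' i| ≤ (M : ℤ)) →
      ‖((g ζ x : (Matrix n n ℂ)ˣ) : Matrix n n ℂ) - ((g ζ' x : (Matrix n n ℂ)ˣ) : Matrix n n ℂ)‖ ≤ 4358144 * ((M : ℝ) ^ 2 * η) := by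
    intro ζ ζ' x hx hx'
    have h := norm_chart_sub_chart_le (d := 4) hUs hU' hgU hM1 hpin (by positivity : (0 : ℝ) ≤ 262144 * (M : ℝ) * η)
      (by positivity : (0 : ℝ) ≤ 20480 * ((M : ℝ) ^ 2 * η)) herr' hS hx hx'
    have : 2 * (((4 : ℕ) : ℝ) * ((M : ℝ) * (262144 * (M : ℝ) * η) + 20480 * ((M : ℝ) ^ 2 * η))) + 2 * ((4 : ℕ) : ℝ) * (M : ℝ) * (262144 * (M : ℝ) * η)
        = 4358144 * ((M : ℝ) ^ 2 * η) := by push_cast; ring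
    rw [this] at h; exact h
  refine ⟨g, hgU, hpin, fun ζ x κ hx => ?_, hgeq, fun ζ ζ' x hx hx' => ?_⟩
  · have h := herr' ζ x κ hx; rw [hMr] at h; exact h
  · have h := hclose ζ ζ' x hx hx'; rw [hMr] at h; exact h

end

end Summit.QuantumFields.BalabanUV.T4Continuum.NE7PairChartDataGeneric
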